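import Mathlib.LinearAlgebra.Matrix.ToLinearEquiv
import Mathlib.LinearAlgebra.Matrix.Determinant.Basic
import Mathlib.LinearAlgebra.FiniteDimensional.Lemmas
import Mathlib.LinearAlgebra.Dimension.Constructions
import HarnessLib

/-!
# The semilinear kernel trick: a singular `σ`-twisted matrix produces a norm of degree four

COR-CM (cell `pub-hodgecm2`), binder seat b04 (gen 26), count-neutral — groundwork (Mathlib only) for the gen-26 FRONTIER
«metacyclic groups with an action of ORDER FOUR» (A7-JUNCTION gen-26 addendum §C, «semilinear determinant trick»): the
ELEMENTARY replacement for Wedderburn's norm criterion / the Brauer-group computation `[𝔄]² = [(L₂/L₀, ω)]` for a cyclic algebra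
`𝔄 = (L/L₀, σ, a)` of degree `4`.

THEOREM (`exists_norm_eq_pow_of_det_eq_zero`).  `L` a field, `σ : L →+* L` with `σ⁴ = id`; square matrices `M, P, P'` over `L`
with the TWIST RELATION `M · P = P' · σ(M)` (`σ` applied entrywise) and `P · σ(P) · σ²(P) · σ³(P) = a · 1` (so `v ↦ P σ(v)` is a
`σ`-semilinear operator `f` with `f⁴ = a`, and `f` preserves `ker M`).  If `det M = 0` and `M ≠ 0` then for some `d` with
`1 ≤ d < size` there is a `z ∈ L` with `z · σ(z) · σ²(z) · σ³(z) = a^d` — namely `z = det B` for the matrix `B` of `f|_{ker M}` in any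
basis (`B σ(B) σ²(B) σ³(B) = a · 1_d`).  In the application `M` is the four-sheet block of a CM type for `C_p ⋊_r C_{2^m}` (`r` of
order `4`, gen 26 `CorCM/FourSheetAnnihilator`), `L = ℚ(ζ_{2^{m−2}p})`, `σ : ζ_p ↦ ζ_p^{r^{±1}}`, `a = χ(q) = ω`; `a^d` a norm for
`d ∈ {1,2,3}` forces `ω²` to be a norm of degree four, refuted by `CorCM/CyclotomicTwoPowerPQuarticNormDescent` when `8 ∤ p − 1`.
KERNEL ONLY: theorems; no definition, no named fact, no `sorry`.

* §1 `map_comp_vec` (`σ ∘ (N *ᵥ w) = σ(N) *ᵥ (σ ∘ w)`), `twist_mulVec_mem_ker` (`f` preserves `ker M`), `twist_pow_four`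
  (`f⁴ = a`).
* §2 **`exists_norm_eq_pow_of_det_eq_zero`**.

## References

* [Pierce1982] R. S. Pierce, *Associative Algebras*, GTM 88, Springer 1982, §15.1 (cyclic algebras; Wedderburn's norm
  criterion) — replaced here by first-year linear algebra.
-/

noncomputable section

open Matrix

namespace Summit.HodgeConjecture.CorCM.SemilinearKernel

variable {L : Type*} [Field L] {ι : Type*} [Fintype ι] [DecidableEq ι]

/-! ## §1 The semilinear operator `v ↦ P σ(v)` -/

omit [DecidableEq ι] in
/-- `σ ∘ (N v) = σ(N) (σ ∘ v)`. [folklore] -/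
theorem map_comp_vec (σ : L →+* L) (N : Matrix ι ι L) (w : ι → L) : σ ∘ (N *ᵥ w) = N.map σ *ᵥ (σ ∘ w) := by
  funext i
  exact RingHom.map_mulVec σ N w i

omit [DecidableEq ι] in
/-- **`f(v) = P σ(v)` maps `ker M` into itself** when `M P = P' σ(M)`. [folklore] -/
theorem twist_mulVec_mem_ker (σ : L →+* L) (M P P' : Matrix ι ι L) (hM : M * P = P' * M.map σ) (v : ι → L)
    (hv : M *ᵥ v = 0) : M *ᵥ (P *ᵥ (σ ∘ v)) = 0 := by
  rw [mulVec_mulVec, hM, ← mulVec_mulVec, ← map_comp_vec, hv]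
  have : σ ∘ (0 : ι → L) = 0 := by funext i; simp
  rw [this, mulVec_zero]

/-- **`f⁴ = a`**: `P σ(P σ(P σ(P σ(v)))) = a v` when `P σ(P) σ²(P) σ³(P) = a · 1` and `σ⁴ = id`. [folklore] -/
theorem twist_pow_four (σ : L →+* L) (hσ4 : ∀ x, σ (σ (σ (σ x))) = x) (P : Matrix ι ι L) (a : L)
    (hP : P * P.map σ * P.map (σ.comp σ) * P.map (σ.comp (σ.comp σ)) = a • (1 : Matrix ι ι L)) (v : ι → L) :
    P *ᵥ (σ ∘ (P *ᵥ (σ ∘ (P *ᵥ (σ ∘ (P *ᵥ (σ ∘ v))))))) = a • v := by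
  have hv4 : σ ∘ (σ ∘ (σ ∘ (σ ∘ v))) = v := by funext i; exact hσ4 (v i)
  rw [map_comp_vec, map_comp_vec, map_comp_vec, map_comp_vec, map_comp_vec, map_comp_vec]
  simp only [Matrix.map_map]
  rw [hv4, mulVec_mulVec, mulVec_mulVec, mulVec_mulVec]
  have e : P * P.map σ * (P.map (⇑σ ∘ ⇑σ)) * (P.map (⇑σ ∘ ⇑σ ∘ ⇑σ)) =
      P * P.map σ * P.map (σ.comp σ) * P.map (σ.comp (σ.comp σ)) := by rfl
  rw [e, hP, Matrix.smul_mulVec, one_mulVec]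

/-! ## §2 The norm of the restricted operator -/

/-- **THE SEMILINEAR KERNEL TRICK.**  `σ⁴ = id`, `M P = P' σ(M)`, `P σ(P) σ²(P) σ³(P) = a · 1`, `det M = 0`, `M ≠ 0`
⟹ `∃ d`, `1 ≤ d < #ι`, `∃ z`, `z σ(z) σ²(z) σ³(z) = a^d`. [cite: Pierce1982, §15.1] -/
theorem exists_norm_eq_pow_of_det_eq_zero (σ : L →+* L) (hσ4 : ∀ x, σ (σ (σ (σ x))) = x) (M P P' : Matrix ι ι L)
    (a : L) (hM : M * P = P' * M.map σ)
    (hP : P * P.map σ * P.map (σ.comp σ) * P.map (σ.comp (σ.comp σ)) = a • (1 : Matrix ι ι L))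
    (hdet : M.det = 0) (hM0 : M ≠ 0) :
    ∃ d : ℕ, 1 ≤ d ∧ d < Fintype.card ι ∧ ∃ z : L, z * σ z * σ (σ z) * σ (σ (σ z)) = a ^ d := by
  classical
  -- the kernel and the semilinear operator on it
  set K : Submodule L (ι → L) := LinearMap.ker (Matrix.toLin' M) with hK_def
  have hmemK : ∀ v : ι → L, v ∈ K ↔ M *ᵥ v = 0 := fun v => by
    rw [hK_def, LinearMap.mem_ker, Matrix.toLin'_apply]
  have hfK : ∀ v : K, P *ᵥ (σ ∘ (v : ι → L)) ∈ K := fun v =>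
    (hmemK _).2 (twist_mulVec_mem_ker σ M P P' hM v ((hmemK _).1 v.2))
  set f : K → K := fun v => ⟨P *ᵥ (σ ∘ (v : ι → L)), hfK v⟩ with hf_def
  have hf_coe : ∀ v : K, ((f v : K) : ι → L) = P *ᵥ (σ ∘ (v : ι → L)) := fun v => rfl
  have hf_add : ∀ v w : K, f (v + w) = f v + f w := fun v w => by
    apply Subtype.ext
    simp only [hf_coe, Submodule.coe_add]
    rw [← mulVec_add]
    congr 1
    funext i; simp
  have hf_smul : ∀ (c : L) (v : K), f (c • v) = σ c • f v := fun c v => by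
    apply Subtype.ext
    simp only [hf_coe, Submodule.coe_smul]
    rw [← mulVec_smul]
    congr 1
    funext i; simp
  have hf4 : ∀ v : K, f (f (f (f v))) = a • v := fun v => by
    apply Subtype.ext
    simp only [hf_coe, Submodule.coe_smul]
    exact twist_pow_four σ hσ4 P a hP _
  -- dimension of the kernel
  set d := Module.finrank L K with hd_def
  have hd1 : 1 ≤ d := by
    obtain ⟨v, hv0, hv⟩ := (Matrix.exists_mulVec_eq_zero_iff (M := M)).2 hdet
    have hvK : v ∈ K := (hmemK v).2 hv
    by_contra h
    have h0 : d = 0 := by omega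
    rw [hd_def, Submodule.finrank_eq_zero] at h0
    rw [h0] at hvK
    exact hv0 ((Submodule.mem_bot L).1 hvK)
  have hdlt : d < Fintype.card ι := by
    have hlt : K < ⊤ := by
      refine lt_top_iff_ne_top.2 fun htop => hM0 ?_
      ext i j
      have hj : (Pi.single j (1 : L) : ι → L) ∈ K := by rw [htop]; exact Submodule.mem_top
      have h := congrFun ((hmemK _).1 hj) i
      simpa [Matrix.mulVec_single_one] using h
    have h := Submodule.finrank_lt_finrank_of_lt hlt
    rwa [finrank_top, Module.finrank_fintype_fun_eq_card] at h
  -- a basis of the kernel and the matrix of `f`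
  set b := Module.finBasis L K with hb_def
  set B : Matrix (Fin d) (Fin d) L := fun l k => b.equivFun (f (b k)) l with hB_def
  -- coordinates: `[f w] = B σ([w])`
  have hcoord : ∀ w : K, b.equivFun (f w) = B *ᵥ (σ ∘ b.equivFun w) := fun w => by
    have hw : w = ∑ k, b.equivFun w k • b k := (b.sum_equivFun w).symm
    have hfw : f w = ∑ k, σ (b.equivFun w k) • f (b k) := by
      conv_lhs => rw [hw]
      have : ∀ (s : Finset (Fin d)), f (∑ k ∈ s, b.equivFun w k • b k) = ∑ k ∈ s, σ (b.equivFun w k) • f (b k) := by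
        intro s
        induction s using Finset.induction_on with
        | empty =>
          apply Subtype.ext
          simp only [Finset.sum_empty, hf_coe, Submodule.coe_zero]
          have : σ ∘ (0 : ι → L) = 0 := by funext i; simp
          rw [this, mulVec_zero]
        | insert k s hk ih => rw [Finset.sum_insert hk, Finset.sum_insert hk, hf_add, hf_smul, ih]
      exact this _
    rw [hfw, map_sum]
    funext l
    simp only [map_smul, Finset.sum_apply, Pi.smul_apply, smul_eq_mul, mulVec, dotProduct, Function.comp_apply, hB_def]
    exact Finset.sum_congr rfl fun k _ => mul_comm _ _
  -- iterate four times: `[f⁴ w] = B σ(B) σ²(B) σ³(B) [w]`, and `f⁴ w = a w`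
  have hiter : ∀ w : K, (B * B.map σ * B.map (σ.comp σ) * B.map (σ.comp (σ.comp σ))) *ᵥ b.equivFun w =
      a • b.equivFun w := fun w => by
    have h := hcoord (f (f (f w)))
    rw [hf4, map_smul, hcoord, hcoord, hcoord, map_comp_vec, map_comp_vec, map_comp_vec, map_comp_vec, map_comp_vec,
      map_comp_vec] at h
    simp only [Matrix.map_map] at h
    have hv4 : ⇑σ ∘ (⇑σ ∘ (⇑σ ∘ (⇑σ ∘ b.equivFun w))) = b.equivFun w := by funext i; exact hσ4 _
    rw [mulVec_mulVec, mulVec_mulVec, mulVec_mulVec] at h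
    simp only [RingHom.coe_comp]
    rw [hv4] at h
    exact h.symm
  have hBB : B * B.map σ * B.map (σ.comp σ) * B.map (σ.comp (σ.comp σ)) = a • (1 : Matrix (Fin d) (Fin d) L) := by
    refine Matrix.toLin'.injective (LinearMap.ext fun c => ?_)
    rw [Matrix.toLin'_apply, Matrix.toLin'_apply, Matrix.smul_mulVec, one_mulVec]
    obtain ⟨w, rfl⟩ : ∃ w : K, b.equivFun w = c := ⟨b.equivFun.symm c, b.equivFun.apply_symm_apply c⟩
    exact hiter w
  -- determinants
  refine ⟨d, hd1, hdlt, B.det, ?_⟩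
  have h := congrArg Matrix.det hBB
  have e1 : (B.map ⇑σ).det = σ B.det := by rw [← RingHom.mapMatrix_apply, ← RingHom.map_det]
  have e2 : (B.map ⇑(σ.comp σ)).det = σ (σ B.det) := by
    rw [← RingHom.mapMatrix_apply, ← RingHom.map_det, RingHom.comp_apply]
  have e3 : (B.map ⇑(σ.comp (σ.comp σ))).det = σ (σ (σ B.det)) := by
    rw [← RingHom.mapMatrix_apply, ← RingHom.map_det, RingHom.comp_apply, RingHom.comp_apply]
  rw [det_mul, det_mul, det_mul, e1, e2, e3, det_smul, det_one, mul_one, Fintype.card_fin] at h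
  exact h

end Summit.HodgeConjecture.CorCM.SemilinearKernel

end
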